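import Summits.Ventures.CertifiedArithmetic.LowPrec.Monotone
import Summits.Ventures.CertifiedArithmetic.LowPrec.DirectedMirror

/-!
# Monotonicity of `RZ`, `RD`, `RU` on all of `ℚ`, saturation included (Theorem E3, every format)

HONEST FRAMING (venture CertifiedArithmetic / cell `pub-lowprec`): certified error envelopes and
provably optimal rounding/accumulation schemes for low-precision formats under stated cost models;
every table by two implementations; no hardware or vendor claims.

THEOREMS-R1 Theorem E3 says that EACH rounding mode is a monotone non-decreasing map
`ℚ → values`, which is why every certified table reports `0` monotonicity violations.
`Monotone.lean` proves it for `roundNE` unconditionally and for `roundDown` / `roundUp` IN RANGE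
(`|x|, |y| ≤ maxRat`, via the optimality characterisations); `roundTowardZero` had no monotonicity
theorem. This file closes both gaps, def-free:

* `Format.rdGrid_mono`, `Format.ruGrid_mono` — the two magnitude grids are monotone on `r ≥ 0`
  with NO range hypothesis: the clamp at `maxScaled` (the satfinite-style delivered result of the
  directed modes in the cell's tables) is itself monotone.
* `MiniFloat.toRat_roundTowardZero_mono` — `RZ` is monotone on all of `ℚ` (E3 for the fourth mode).
* `MiniFloat.toRat_roundDown_mono'`, `MiniFloat.toRat_roundUp_mono'` — `RD`, `RU` monotone on all
  of `ℚ`, the range hypotheses of `toRat_roundDown_mono` / `toRat_roundUp_mono` removed.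
-/

namespace Literature.ComputerArithmetic.FloatingPoint

namespace Format

variable {φ : Format}

/-- The round-down grid is monotone on `r ≥ 0` (no range hypothesis): `rdGrid r₁` is a
representable magnitude `≤ r₁ ≤ r₂`, hence `≤ rdGrid r₂` by optimality. [folklore] -/
theorem rdGrid_mono {r₁ r₂ : ℚ} (h₁ : 0 ≤ r₁) (h : r₁ ≤ r₂) : φ.rdGrid r₁ ≤ φ.rdGrid r₂ :=
  le_rdGrid_of_le (le_trans h₁ h) (rdGrid_representable r₁) (le_trans (rdGrid_le h₁) h)

/-- The round-up grid is monotone on `r ≥ 0` (no range hypothesis): in range by optimality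
(`ruGrid r₂` is representable and `≥ r₂ ≥ r₁`), and beyond `maxScaled` the grid saturates at
`maxScaled ≥ ruGrid r₁`. [folklore] -/
theorem ruGrid_mono {r₁ r₂ : ℚ} (h₁ : 0 ≤ r₁) (h : r₁ ≤ r₂) : φ.ruGrid r₁ ≤ φ.ruGrid r₂ := by
  have h₂ : 0 ≤ r₂ := le_trans h₁ h
  by_cases hle : r₂ ≤ φ.maxScaled
  · exact ruGrid_le_of_le h₁ (le_trans h hle) (ruGrid_representable h₂)
      (le_trans h (le_ruGrid hle))
  · have e : φ.ruGrid r₂ = φ.maxScaled := by unfold ruGrid; rw [if_neg hle]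
    rw [e]; exact ruGrid_le_maxScaled h₁

end Format

namespace MiniFloat

open Format

variable {φ : Format}

/-- E3 for the fourth mode: ROUND-TOWARD-ZERO IS MONOTONE as a map `ℚ → values`, for every format,
saturation included (no range hypothesis). Cases: `0 ≤ x ≤ y` by `rdGrid_mono`; `x ≤ y < 0` by
`rdGrid_mono` on the magnitudes `|y| ≤ |x|`; `x < 0 ≤ y` through `0`. [folklore] -/
theorem toRat_roundTowardZero_mono {x y : ℚ} (hxy : x ≤ y) :
    (roundTowardZero φ x).toRat ≤ (roundTowardZero φ y).toRat := by
  have hq := φ.quantum_pos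
  rw [toRat_roundTowardZero, toRat_roundTowardZero]
  by_cases hx : x < 0
  · by_cases hy : y < 0
    · rw [if_pos hx, if_pos hy, abs_of_neg hx, abs_of_neg hy]
      have hm : φ.rdGrid (-y / φ.quantum) ≤ φ.rdGrid (-x / φ.quantum) :=
        rdGrid_mono (div_nonneg (by linarith) hq.le) (div_le_div_of_nonneg_right (by linarith) hq.le)
      have hm' : (φ.rdGrid (-y / φ.quantum) : ℚ) ≤ φ.rdGrid (-x / φ.quantum) := by exact_mod_cast hm
      nlinarith
    · rw [if_pos hx, if_neg hy]
      have h1 : (0 : ℚ) ≤ φ.rdGrid (|y| / φ.quantum) := Nat.cast_nonneg _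
      have h2 : (0 : ℚ) ≤ φ.rdGrid (|x| / φ.quantum) := Nat.cast_nonneg _
      nlinarith
  · have hy : ¬ y < 0 := fun h => hx (lt_of_le_of_lt hxy h)
    rw [if_neg hx, if_neg hy, abs_of_nonneg (not_lt.mp hx), abs_of_nonneg (not_lt.mp hy)]
    have hm : φ.rdGrid (x / φ.quantum) ≤ φ.rdGrid (y / φ.quantum) :=
      rdGrid_mono (div_nonneg (not_lt.mp hx) hq.le) (div_le_div_of_nonneg_right hxy hq.le)
    have hm' : (φ.rdGrid (x / φ.quantum) : ℚ) ≤ φ.rdGrid (y / φ.quantum) := by exact_mod_cast hm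
    exact mul_le_mul_of_nonneg_right hm' hq.le

/-- E3: ROUND-DOWN IS MONOTONE on all of `ℚ`, saturation included (`toRat_roundDown_mono` without
its range hypotheses). For `x ≤ y < 0` the magnitudes are rounded UP and `ruGrid_mono` applies to
`|y| ≤ |x|`. [folklore] -/
theorem toRat_roundDown_mono' {x y : ℚ} (hxy : x ≤ y) :
    (roundDown φ x).toRat ≤ (roundDown φ y).toRat := by
  have hq := φ.quantum_pos
  rw [toRat_roundDown, toRat_roundDown]
  by_cases hx : x < 0
  · by_cases hy : y < 0
    · rw [if_pos hx, if_pos hy, abs_of_neg hx, abs_of_neg hy]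
      have hm : φ.ruGrid (-y / φ.quantum) ≤ φ.ruGrid (-x / φ.quantum) :=
        ruGrid_mono (div_nonneg (by linarith) hq.le) (div_le_div_of_nonneg_right (by linarith) hq.le)
      have hm' : (φ.ruGrid (-y / φ.quantum) : ℚ) ≤ φ.ruGrid (-x / φ.quantum) := by exact_mod_cast hm
      nlinarith
    · rw [if_pos hx, if_neg hy]
      have h1 : (0 : ℚ) ≤ φ.rdGrid (|y| / φ.quantum) := Nat.cast_nonneg _
      have h2 : (0 : ℚ) ≤ φ.ruGrid (|x| / φ.quantum) := Nat.cast_nonneg _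
      nlinarith
  · have hy : ¬ y < 0 := fun h => hx (lt_of_le_of_lt hxy h)
    rw [if_neg hx, if_neg hy, abs_of_nonneg (not_lt.mp hx), abs_of_nonneg (not_lt.mp hy)]
    have hm : φ.rdGrid (x / φ.quantum) ≤ φ.rdGrid (y / φ.quantum) :=
      rdGrid_mono (div_nonneg (not_lt.mp hx) hq.le) (div_le_div_of_nonneg_right hxy hq.le)
    have hm' : (φ.rdGrid (x / φ.quantum) : ℚ) ≤ φ.rdGrid (y / φ.quantum) := by exact_mod_cast hm
    exact mul_le_mul_of_nonneg_right hm' hq.le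

/-- E3: ROUND-UP IS MONOTONE on all of `ℚ`, saturation included (`toRat_roundUp_mono` without its
range hypotheses) — the mirror image of `toRat_roundDown_mono'` (`RU(x) = -RD(-x)`). [folklore] -/
theorem toRat_roundUp_mono' {x y : ℚ} (hxy : x ≤ y) :
    (roundUp φ x).toRat ≤ (roundUp φ y).toRat := by
  have h := toRat_roundDown_mono' (φ := φ) (neg_le_neg hxy)
  rw [← neg_neg x, ← neg_neg y, toRat_roundUp_neg, toRat_roundUp_neg]
  linarith

end MiniFloat

end Literature.ComputerArithmetic.FloatingPoint
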